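/-
Copyright (c) 2026. All rights reserved.
Released under Apache 2.0 license as described in the file LICENSE.
-/
import Literature.NumberTheory.Weil1964.AdelicEisensteinBigCellTerm
import HarnessLib

/-!
# The big Bruhat cell relative to the Siegel parabolic: `g ∈ P_Y · J · v(σ)` read on vectors, and the big-cell term of the
# doubled Siegel–Eisenstein series under that criterion

Topic `NumberTheory/Weil1964`; namespace `Literature.NumberTheory.Weil1964`.  KERNEL MATHEMATICS ONLY (theorems over existing tree
declarations; no `def … : Prop`, no `axiom`, no proof hole).  Sequel of ★ `AdelicEisensteinBigCellTerm` (the section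
`(ω(r_F(p · J · v(σ)))Φ)(0) = ∫ Φ ψ_F(−½ᵗuσu)`): there the big-cell shape `δ x δ⁻¹ = p · J · v(σ)`, `ratSp p ∈ P_𝕐(𝔸)`, is a
HYPOTHESIS with an existential flavour (`p`); here it is turned into the checkable form consumers meet.

THE PRINT.  [Weil1964, Chap. I n° 6 p. 151, n° 13 p. 160; Chap. III n° 46 (42) p. 202]: `Sp(X)` is the disjoint union of the cells
`P(X) w_r P(X)`; an element `g` lies in the BIG cell `P w P = P · w · N` iff `g⁻¹Y` is transversal to `Y`, and then
`g = p · w · t(f)` with `f` the character of the second degree whose graph is `g⁻¹ Y` ([Kudla1994, §3]; [GelbartPiatetskishapiroRallis1987,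
Part A §2]: the open orbit).  In the tree's coordinates (`AdelicSiegelParabolicLift`: `P_Y = siegelParabolicPi T = {p | p Y = Y}`,
`Y = 0 × 𝔸ⁿ`; `v(σ) = low σ` acts by `(x, y) ↦ (x, y + T⁻¹σx)`; `J` by `(x, y) ↦ (−Ty, T⁻¹x)`):

* §1 `eq_mul_symJ_mul_low` — the group identity `g = (g · v(σ)⁻¹ · J⁻¹) · J · v(σ)`; hence the big-cell term theorems of ★
  `AdelicEisensteinBigCellTerm` with the single hypothesis `ratSp (g · v(σ)⁻¹ · J⁻¹) ∈ P_Y(𝔸)`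
  (`omega_ratThetaLiftCont_apply_zero_of_mem_bigCell`, `omega_doublingDeltaLift_omega_ratThetaLiftCont_apply_zero_of_mem_bigCell`);
* §2 `ratSp_mul_low_inv_mul_symJ_inv_apply_zero` ∕ `…_symm_apply_zero` — ON VECTORS: `ratSp (g · v(σ)⁻¹ · J⁻¹) (0, y) =
  ratSp g (Ty, −T⁻¹ σ T y)` and `(ratSp (g · v(σ)⁻¹ · J⁻¹))⁻¹ w = J(v(σ)((ratSp g)⁻¹ w))`, whence the CRITERION
  **`ratSp_mul_low_inv_mul_symJ_inv_mem_siegelParabolicPi_iff`**: `ratSp (g · v(σ)⁻¹ · J⁻¹) ∈ P_Y(𝔸)` iff `ratSp g` carries the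
  graph `{(a, −T⁻¹σa)}` into `Y` and `(ratSp g)⁻¹` carries `Y` into that graph (first-component∕graph equations).

Cell `hodgecm-mathlib`, P4 ∕ E-2, row (6) SW2-EIS-UNFOLD piece (C0) (B-p02 (g18)); consumer: piece (C) (the rank-one Bruhat
representatives of `PW\IW`, where `g := δ (m γ)⁻¹ δ⁻¹` and the graph is `δ(V ⊗ ℓ_γ)` for the isotropic line `ℓ_γ ≠ W^Δ`).  HC_CM is
proved only modulo the printed citations until rung 0 closes — nothing here bears on it.

## References
* [Weil1964] A. Weil, Acta Math. 111 (1964): Chap. I n° 6 p. 151 (`P(X)`, `d₀'`), n° 13 p. 160; Chap. III n° 46 (42) p. 202.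
* [Weil1965] A. Weil, Acta Math. 113 (1965): n° 39 (30) p. 55, n° 46 p. 66 (`Ps_k = P_k ∪ P_k w N_k`).
* [Kudla1994] S. S. Kudla, Israel J. Math. 87 (1994), §3 (Bruhat cells relative to the Siegel parabolic).
* [GelbartPiatetskishapiroRallis1987] LNM 1254, Part A §2 pp. 7–9.
-/

set_option autoImplicit false

noncomputable section

namespace Literature.NumberTheory.Weil1964

open Literature.RepresentationTheory.HeisenbergGroup Literature.RepresentationTheory.HeisenbergGroup.SymplecticMatrix
open Literature.NumberTheory.Automorphic
open NumberField _root_.MeasureTheory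
open scoped Matrix

section Generic

variable (F : Type) [Field F] [NumberField F] {n : ℕ}
variable (T : Matrix (Fin n) (Fin n) (AdeleRing (𝓞 F) F)) (hT : IsUnit T.det)

/-! ## §1 The big-cell term under the single hypothesis `ratSp (g · v(σ)⁻¹ · J⁻¹) ∈ P_Y(𝔸)` -/

omit [NumberField F] in
/-- `g = (g v(σ)⁻¹ J⁻¹) · J · v(σ)`. [cite: Weil1964, Chap. III n° 46 (42) p. 202] -/
theorem eq_mul_symJ_mul_low (g : Matrix.symplecticGroup (Fin n) F) (σ : Matrix (Fin n) (Fin n) F) (hσ : σ.IsSymm) :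
    g = g * (low σ hσ)⁻¹ * (SymplecticGroup.symJ (Fin n) F)⁻¹ * SymplecticGroup.symJ (Fin n) F * low σ hσ := by
  group

variable [MeasurableSpace (AdeleRing (𝓞 F) F)] [BorelSpace (AdeleRing (𝓞 F) F)]
  (ν : Measure (Fin n → AdeleRing (𝓞 F) F)) [ν.IsAddHaarMeasure]

/-- **The section on the big cell, membership form**: if `ratSp (g · v(σ)⁻¹ · J⁻¹) ∈ P_Y(𝔸)` then
`(ω(r_F g)Φ)(0) = ∫ u, ψ_F(−½ᵗuσu) Φ(u) ∂ν` (★ `omega_ratThetaLiftCont_bigCell_apply_zero` at `p := g v(σ)⁻¹ J⁻¹`).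
[cite: Weil1965, n° 39 (30) p. 55] [cite: Weil1964, Chap. I n° 13 p. 160] -/
theorem omega_ratThetaLiftCont_apply_zero_of_mem_bigCell (hν : ν (piFundamentalDomain F (Fin n)) = 1)
    (g : Matrix.symplecticGroup (Fin n) F) (σ : Matrix (Fin n) (Fin n) F) (hσ : σ.IsSymm)
    (hg : ratSp F T hT (g * (low σ hσ)⁻¹ * (SymplecticGroup.symJ (Fin n) F)⁻¹) ∈ siegelParabolicPi T)
    (Φ : piSchwartzBruhat F (Fin n)) :
    ((adelicMpCont.omega F (Fin n) T (ratThetaLiftCont F T hT g) Φ : piSchwartzBruhat F (Fin n)) :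
        (Fin n → AdeleRing (𝓞 F) F) → ℂ) 0 =
      ∫ v, chirp F ((-⅟(2 : AdeleRing (𝓞 F) F)) • ratMatrix F σ) (Φ : (Fin n → AdeleRing (𝓞 F) F) → ℂ) v ∂ν := by
  have h := omega_ratThetaLiftCont_bigCell_apply_zero F T hT ν hν
    (g * (low σ hσ)⁻¹ * (SymplecticGroup.symJ (Fin n) F)⁻¹) hg σ hσ Φ
  have e : g * (low σ hσ)⁻¹ * (SymplecticGroup.symJ (Fin n) F)⁻¹ * SymplecticGroup.symJ (Fin n) F * low σ hσ = g := by
    group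
  exact (congrArg (fun q => ((adelicMpCont.omega F (Fin n) T (ratThetaLiftCont F T hT q) Φ : piSchwartzBruhat F (Fin n)) :
      (Fin n → AdeleRing (𝓞 F) F) → ℂ) 0) e).symm.trans h

end Generic

/-! ## §2 The criterion on vectors -/

section Criterion

variable (F : Type) [Field F] [NumberField F] {n : ℕ}
variable (T : Matrix (Fin n) (Fin n) (AdeleRing (𝓞 F) F)) (hT : IsUnit T.det)

/-- **`ratSp (g v(σ)⁻¹ J⁻¹) (0, y) = ratSp g (T y, −T⁻¹ σ T y)`**: `J⁻¹(0, y) = (T y, 0)` and `v(σ)⁻¹ (x, 0) = (x, −T⁻¹σx)`.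
[cite: Weil1964, Chap. I n° 6 p. 151] -/
theorem ratSp_mul_low_inv_mul_symJ_inv_apply_zero (g : Matrix.symplecticGroup (Fin n) F) (σ : Matrix (Fin n) (Fin n) F)
    (hσ : σ.IsSymm) (y : Fin n → AdeleRing (𝓞 F) F) :
    ((ratSp F T hT (g * (low σ hσ)⁻¹ * (SymplecticGroup.symJ (Fin n) F)⁻¹) :
        symplecticGroup (polar (adelicForm F (Fin n) T))) :
        ((Fin n → AdeleRing (𝓞 F) F) × (Fin n → AdeleRing (𝓞 F) F)) ≃ₗ[AdeleRing (𝓞 F) F]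
          ((Fin n → AdeleRing (𝓞 F) F) × (Fin n → AdeleRing (𝓞 F) F))) (0, y) =
      ((ratSp F T hT g : symplecticGroup (polar (adelicForm F (Fin n) T))) :
        ((Fin n → AdeleRing (𝓞 F) F) × (Fin n → AdeleRing (𝓞 F) F)) ≃ₗ[AdeleRing (𝓞 F) F]
          ((Fin n → AdeleRing (𝓞 F) F) × (Fin n → AdeleRing (𝓞 F) F)))
        (T *ᵥ y, -((T⁻¹ * ratMatrix F σ) *ᵥ (T *ᵥ y))) := by
  have h1 : (((ratSp F T hT (SymplecticGroup.symJ (Fin n) F))⁻¹ : symplecticGroup (polar (adelicForm F (Fin n) T))) :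
        ((Fin n → AdeleRing (𝓞 F) F) × (Fin n → AdeleRing (𝓞 F) F)) ≃ₗ[AdeleRing (𝓞 F) F]
          ((Fin n → AdeleRing (𝓞 F) F) × (Fin n → AdeleRing (𝓞 F) F))) (0, y) = (T *ᵥ y, 0) := by
    rw [ratSp_J]
    change (weylσ (weylGamma T hT) (gramEquiv T hT).symm).symm (0, y) = _
    rw [weylσ_symm_apply]
    simp
  have h2 : (((ratSp F T hT (low σ hσ))⁻¹ : symplecticGroup (polar (adelicForm F (Fin n) T))) :
        ((Fin n → AdeleRing (𝓞 F) F) × (Fin n → AdeleRing (𝓞 F) F)) ≃ₗ[AdeleRing (𝓞 F) F]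
          ((Fin n → AdeleRing (𝓞 F) F) × (Fin n → AdeleRing (𝓞 F) F))) (T *ᵥ y, 0) =
      (T *ᵥ y, -((T⁻¹ * ratMatrix F σ) *ᵥ (T *ᵥ y))) := by
    rw [ratSp_low]
    change (unipotentσ (lowLin T (ratMatrix F σ))).symm (T *ᵥ y, 0) = _
    rw [unipotentσ_symm_apply, lowLin_apply, zero_sub]
  rw [map_mul, map_mul, map_inv, map_inv]
  exact (congrArg (fun v => ((ratSp F T hT g : symplecticGroup (polar (adelicForm F (Fin n) T))) :
      ((Fin n → AdeleRing (𝓞 F) F) × (Fin n → AdeleRing (𝓞 F) F)) ≃ₗ[AdeleRing (𝓞 F) F]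
        ((Fin n → AdeleRing (𝓞 F) F) × (Fin n → AdeleRing (𝓞 F) F))) v)
    ((congrArg (fun v => (((ratSp F T hT (low σ hσ))⁻¹ : symplecticGroup (polar (adelicForm F (Fin n) T))) :
      ((Fin n → AdeleRing (𝓞 F) F) × (Fin n → AdeleRing (𝓞 F) F)) ≃ₗ[AdeleRing (𝓞 F) F]
        ((Fin n → AdeleRing (𝓞 F) F) × (Fin n → AdeleRing (𝓞 F) F))) v) h1).trans h2) :)

/-- **`(ratSp (g v(σ)⁻¹ J⁻¹))⁻¹ w = J (v(σ) ((ratSp g)⁻¹ w))`**, first component: `−T (b + T⁻¹σ a)` for `(a, b) = (ratSp g)⁻¹ w`.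
[cite: Weil1964, Chap. I n° 6 p. 151] -/
theorem ratSp_mul_low_inv_mul_symJ_inv_symm_apply_fst (g : Matrix.symplecticGroup (Fin n) F) (σ : Matrix (Fin n) (Fin n) F)
    (hσ : σ.IsSymm) (w : (Fin n → AdeleRing (𝓞 F) F) × (Fin n → AdeleRing (𝓞 F) F)) :
    (((ratSp F T hT (g * (low σ hσ)⁻¹ * (SymplecticGroup.symJ (Fin n) F)⁻¹) :
        symplecticGroup (polar (adelicForm F (Fin n) T))) :
        ((Fin n → AdeleRing (𝓞 F) F) × (Fin n → AdeleRing (𝓞 F) F)) ≃ₗ[AdeleRing (𝓞 F) F]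
          ((Fin n → AdeleRing (𝓞 F) F) × (Fin n → AdeleRing (𝓞 F) F))).symm w).1 =
      -(T *ᵥ ((((ratSp F T hT g : symplecticGroup (polar (adelicForm F (Fin n) T))) :
        ((Fin n → AdeleRing (𝓞 F) F) × (Fin n → AdeleRing (𝓞 F) F)) ≃ₗ[AdeleRing (𝓞 F) F]
          ((Fin n → AdeleRing (𝓞 F) F) × (Fin n → AdeleRing (𝓞 F) F))).symm w).2 +
        (T⁻¹ * ratMatrix F σ) *ᵥ (((ratSp F T hT g : symplecticGroup (polar (adelicForm F (Fin n) T))) :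
        ((Fin n → AdeleRing (𝓞 F) F) × (Fin n → AdeleRing (𝓞 F) F)) ≃ₗ[AdeleRing (𝓞 F) F]
          ((Fin n → AdeleRing (𝓞 F) F) × (Fin n → AdeleRing (𝓞 F) F))).symm w).1)) := by
  have hinv : (ratSp F T hT (g * (low σ hσ)⁻¹ * (SymplecticGroup.symJ (Fin n) F)⁻¹))⁻¹ =
      ratSp F T hT (SymplecticGroup.symJ (Fin n) F) * ratSp F T hT (low σ hσ) * (ratSp F T hT g)⁻¹ := by
    simp only [map_mul, map_inv, mul_inv_rev, inv_inv, mul_assoc]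
  have hsymm : (((ratSp F T hT (g * (low σ hσ)⁻¹ * (SymplecticGroup.symJ (Fin n) F)⁻¹) :
        symplecticGroup (polar (adelicForm F (Fin n) T))) :
        ((Fin n → AdeleRing (𝓞 F) F) × (Fin n → AdeleRing (𝓞 F) F)) ≃ₗ[AdeleRing (𝓞 F) F]
          ((Fin n → AdeleRing (𝓞 F) F) × (Fin n → AdeleRing (𝓞 F) F))).symm w) =
      (((ratSp F T hT (g * (low σ hσ)⁻¹ * (SymplecticGroup.symJ (Fin n) F)⁻¹))⁻¹ :
        symplecticGroup (polar (adelicForm F (Fin n) T))) :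
        ((Fin n → AdeleRing (𝓞 F) F) × (Fin n → AdeleRing (𝓞 F) F)) ≃ₗ[AdeleRing (𝓞 F) F]
          ((Fin n → AdeleRing (𝓞 F) F) × (Fin n → AdeleRing (𝓞 F) F))) w := rfl
  rw [hsymm, hinv]
  have hc : ((ratSp F T hT (SymplecticGroup.symJ (Fin n) F) * ratSp F T hT (low σ hσ) * (ratSp F T hT g)⁻¹ :
        symplecticGroup (polar (adelicForm F (Fin n) T))) :
        ((Fin n → AdeleRing (𝓞 F) F) × (Fin n → AdeleRing (𝓞 F) F)) ≃ₗ[AdeleRing (𝓞 F) F]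
          ((Fin n → AdeleRing (𝓞 F) F) × (Fin n → AdeleRing (𝓞 F) F))) w =
      ((ratSp F T hT (SymplecticGroup.symJ (Fin n) F) : symplecticGroup (polar (adelicForm F (Fin n) T))) :
        ((Fin n → AdeleRing (𝓞 F) F) × (Fin n → AdeleRing (𝓞 F) F)) ≃ₗ[AdeleRing (𝓞 F) F]
          ((Fin n → AdeleRing (𝓞 F) F) × (Fin n → AdeleRing (𝓞 F) F)))
        (((ratSp F T hT (low σ hσ) : symplecticGroup (polar (adelicForm F (Fin n) T))) :
          ((Fin n → AdeleRing (𝓞 F) F) × (Fin n → AdeleRing (𝓞 F) F)) ≃ₗ[AdeleRing (𝓞 F) F]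
            ((Fin n → AdeleRing (𝓞 F) F) × (Fin n → AdeleRing (𝓞 F) F)))
          (((ratSp F T hT g : symplecticGroup (polar (adelicForm F (Fin n) T))) :
            ((Fin n → AdeleRing (𝓞 F) F) × (Fin n → AdeleRing (𝓞 F) F)) ≃ₗ[AdeleRing (𝓞 F) F]
              ((Fin n → AdeleRing (𝓞 F) F) × (Fin n → AdeleRing (𝓞 F) F))).symm w)) := rfl
  rw [hc, ratSp_J, ratSp_low, coe_weylSp, coe_unipotentSp, weylσ_apply, unipotentσ_apply, weylGamma_apply, lowLin_apply]

/-- **THE BIG-CELL CRITERION ON VECTORS**: `ratSp (g · v(σ)⁻¹ · J⁻¹) ∈ P_Y(𝔸)` iff `ratSp g` maps the graph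
`{(a, −T⁻¹σ a) : a = T y}` into `Y = {(0, ·)}` and `(ratSp g)⁻¹` maps `Y` into that graph — i.e. `g⁻¹ Y` IS the graph of
`−T⁻¹σ` («`g = p · w · t(f)` with `f` read off `g⁻¹Y`»). [cite: Weil1964, Chap. III n° 46 (42) p. 202] [cite: Kudla1994, §3] -/
theorem ratSp_mul_low_inv_mul_symJ_inv_mem_siegelParabolicPi_iff (g : Matrix.symplecticGroup (Fin n) F)
    (σ : Matrix (Fin n) (Fin n) F) (hσ : σ.IsSymm) :
    ratSp F T hT (g * (low σ hσ)⁻¹ * (SymplecticGroup.symJ (Fin n) F)⁻¹) ∈ siegelParabolicPi T ↔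
      (∀ y : Fin n → AdeleRing (𝓞 F) F,
        (((ratSp F T hT g : symplecticGroup (polar (adelicForm F (Fin n) T))) :
          ((Fin n → AdeleRing (𝓞 F) F) × (Fin n → AdeleRing (𝓞 F) F)) ≃ₗ[AdeleRing (𝓞 F) F]
            ((Fin n → AdeleRing (𝓞 F) F) × (Fin n → AdeleRing (𝓞 F) F)))
          (T *ᵥ y, -((T⁻¹ * ratMatrix F σ) *ᵥ (T *ᵥ y)))).1 = 0) ∧
      ∀ y : Fin n → AdeleRing (𝓞 F) F,
        (((ratSp F T hT g : symplecticGroup (polar (adelicForm F (Fin n) T))) :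
          ((Fin n → AdeleRing (𝓞 F) F) × (Fin n → AdeleRing (𝓞 F) F)) ≃ₗ[AdeleRing (𝓞 F) F]
            ((Fin n → AdeleRing (𝓞 F) F) × (Fin n → AdeleRing (𝓞 F) F))).symm (0, y)).2 =
          -((T⁻¹ * ratMatrix F σ) *ᵥ (((ratSp F T hT g : symplecticGroup (polar (adelicForm F (Fin n) T))) :
            ((Fin n → AdeleRing (𝓞 F) F) × (Fin n → AdeleRing (𝓞 F) F)) ≃ₗ[AdeleRing (𝓞 F) F]
              ((Fin n → AdeleRing (𝓞 F) F) × (Fin n → AdeleRing (𝓞 F) F))).symm (0, y)).1) := by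
  rw [mem_siegelParabolicPi_iff]
  refine and_congr (forall_congr' fun y => ?_) (forall_congr' fun y => ?_)
  · rw [ratSp_mul_low_inv_mul_symJ_inv_apply_zero F T hT g σ hσ y]
  · rw [ratSp_mul_low_inv_mul_symJ_inv_symm_apply_fst F T hT g σ hσ (0, y), neg_eq_zero, ← gramEquiv_apply T hT,
      (gramEquiv T hT).map_eq_zero_iff, add_eq_zero_iff_eq_neg]

end Criterion

/-! ## §3 The doubling form under the membership hypothesis -/

section Doubling

variable (F : Type) [Field F] [NumberField F] {n : ℕ}
variable (T : Matrix (Fin n) (Fin n) (AdeleRing (𝓞 F) F)) (hT : IsUnit T.det)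
variable [MeasurableSpace (AdeleRing (𝓞 F) F)] [BorelSpace (AdeleRing (𝓞 F) F)]
  (ν : Measure (Fin (n + n) → AdeleRing (𝓞 F) F)) [ν.IsAddHaarMeasure]

/-- **THE BIG-CELL TERM OF THE DOUBLED SIEGEL–EISENSTEIN SERIES, membership form**: if
`ratSp (δ x δ⁻¹ · v(σ)⁻¹ · J⁻¹) ∈ P_𝕐(𝔸)` (checkable on vectors by `ratSp_mul_low_inv_mul_symJ_inv_mem_siegelParabolicPi_iff`) then
`(ω□(r_F δ)(ω□(r_F x) Ψ))(0) = ∫ u, ψ_F(−½ ᵗu σ u) (ω□(r_F δ)Ψ)(u) ∂ν` (★ `omega_doublingDeltaLift_omega_ratThetaLiftCont_apply_zero_of_bigCell`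
at `p := δxδ⁻¹ v(σ)⁻¹ J⁻¹`). [cite: Weil1965, n° 39 (30) p. 55] [cite: Weil1965, n° 46 p. 66] [cite: Weil1964, Chap. I n° 13 p. 160] -/
theorem omega_doublingDeltaLift_omega_ratThetaLiftCont_apply_zero_of_mem_bigCell
    (hν : ν (piFundamentalDomain F (Fin (n + n))) = 1) (x : Matrix.symplecticGroup (Fin (n + n)) F)
    (σ : Matrix (Fin (n + n)) (Fin (n + n)) F) (hσ : σ.IsSymm)
    (hq : ratSp F (doubledGramFin F T) (isUnit_det_doubledGramFin F T hT)
        (doublingDeltaRat F * x * (doublingDeltaRat F)⁻¹ * (low σ hσ)⁻¹ * (SymplecticGroup.symJ (Fin (n + n)) F)⁻¹) ∈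
      siegelParabolicPi (doubledGramFin F T))
    (Ψ : piSchwartzBruhat F (Fin (n + n))) :
    ((adelicMpCont.omega F (Fin (n + n)) (doubledGramFin F T) (doublingDeltaLift F T hT)
          (adelicMpCont.omega F (Fin (n + n)) (doubledGramFin F T)
            (ratThetaLiftCont F (doubledGramFin F T) (isUnit_det_doubledGramFin F T hT) x) Ψ) :
          piSchwartzBruhat F (Fin (n + n))) : (Fin (n + n) → AdeleRing (𝓞 F) F) → ℂ) 0 =
      ∫ v, chirp F ((-⅟(2 : AdeleRing (𝓞 F) F)) • ratMatrix F σ)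
        ((adelicMpCont.omega F (Fin (n + n)) (doubledGramFin F T) (doublingDeltaLift F T hT) Ψ :
            piSchwartzBruhat F (Fin (n + n))) : (Fin (n + n) → AdeleRing (𝓞 F) F) → ℂ) v ∂ν :=
  omega_doublingDeltaLift_omega_ratThetaLiftCont_apply_zero_of_bigCell F T hT ν hν x _ σ hσ hq (by group) Ψ

end Doubling

end Literature.NumberTheory.Weil1964

end
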